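import Summits.QuantumFields.YangMills.Theorems.BalabanLadderIRTwistedSlabClassificationGlue
import HarnessLib

/-!
# RESHAPE PROPOSAL R1 for stub T1 of LINE `twisted-slab-continuity` (census row 43) — LEAD prover ym-ir-line-tsc-p1 g6, 2026-08-29
# (a PROPOSAL for the line owner ym-ir-idea-20; NOT a line file, NOT registered; the owner keeps the card and any reshape)

WHAT: replace the single stub `stub_anchor : TwistedSlabAnchor` of `Cruxes/IRcof/Lines/twisted_slab_continuity.lean` by TWO stubs whose conjunction
gives it BY NAME through the landed glue K41 `twistedSlabAnchor_of_classification_of_su` (p703209):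

* `stub_isolatingTwistClassification` — «a compact simple simply-connected `G` with a central `z ≠ 1` carrying an isolating twist is `SU(N)` with
  `z = ω^k·1`, `k` a unit, via a bi-continuous group isomorphism» (Borel–Friedman–Morgan, Mem. AMS 747 (2002) Prop. 4.1.1 + the classification of
  compact simple Lie groups; within type `A` the tree's `IsolatingTwistIffGenerating`).  DECLARED RESIDUAL of the `∀ G` binder: classical, published,
  absent from Mathlib and from the tree, XL; width 0 (precedent: `stub_residual`, `stub_irnscCof`).
* `stub_anchorSU` — T1 TYPED AT `SU(N)`: for `N ≥ 2`, `k` a unit, `n ≥ 1` with `(ω^k·1)^n = 1` and EVERY faithful `r : LatticeRep SU(N)`,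
  `∃ ℓ₀ β₀ c C, 2 ≤ ℓ₀ ∧ 0 < c ∧ ∀ β ≥ β₀ ∀ L ≥ 2 ∀ t ≥ 1, projSlabDefect r.ρ β (ω^k·1) n ℓ₀ L t ≤ C·L·e^{−ct}` — the LOCATED content: by the landed
  r-port (pool-p3 №56 + lit-4 L37) and K38∕K39 this holds up to the transposition `∀L∃β₀ → ∃β₀∀L`, which is M4 (memo §16.3); K44 shows the prefactor
  `C·L` cannot be dropped, K42 that what is proved is the window form `L ≤ Λ(β) → ∞`.

WHY: the present `stub_anchor` quantifies over an abstract `G`; no in-tree proof can transport the `SU(N)` theorems to it without the isomorphism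
`e : G ≃* SU(N)` that only the classification provides (memo §16.2). R1 makes that debt VISIBLE as a named located stub next to `stub_residual` and
leaves `stub_anchorSU` as the honest analytic target (= M4 after the r-port).  The composition `pxcof_of … IRcof_of_stubs` is UNCHANGED: it consumes
`anchor_of_stubs : TwistedSlabAnchor` below in place of `stub_anchor` (the line file's `TwistedSlabContinuity.TwistedSlabAnchor` and the Defs copy
`TwistedSlab.TwistedSlabAnchor` are the same term, `Iff.rfl`∕`rfl` at the use site).  Census effect: row 43 would read «T1 = {CLASSIFICATION (declared
residual, XL) , ANCHOR-SU (located: M4)}» instead of one cell mixing a binder debt with an analytic one.  crit-3 l.1829 (4) ∕ l.1856: honest either way,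
provided the classification is shown as a located line item, never as silently discharged — which is exactly what this cut does.

This file ELABORATES (two `sorry`s = the two proposed stubs; the glue theorem is kernel-checked).  HONEST LABEL: a typed proposal; nothing new is
proved here; T1 0∕1; IRcof ∕ IR 0∕1; the Yang–Mills mass gap (Clay) is NOT proved; R4 = `BalabanLadder.UV` only.
-/

set_option autoImplicit false

noncomputable section

open Literature.MathematicalPhysics.QuantumFieldTheory Literature.MathematicalPhysics.QuantumLattice
open Summit.QuantumFields.YangMills.Cruxes.IRcof.TwistedSlab

namespace Summit.QuantumFields.YangMills.Cruxes.IRcof.TwistedSlabContinuity.ReshapeR1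

/-- **proposed stub (declared residual of the `∀ G` binder)** — isolating twist on a compact simple simply-connected `G` ⇒ `G ≃ SU(N)`,
`z ↦ ω^k·1` with `k` a unit (BFM 2002 Prop. 4.1.1 + classification). -/
theorem stub_isolatingTwistClassification :
    ∀ (G : Type) [Group G] [TopologicalSpace G] [IsTopologicalGroup G] [CompactSpace G],
      IsCompactSimpleLieGroup G → SimplyConnectedSpace G →
      ∀ z : G, z ∈ Subgroup.center G → z ≠ 1 → HasIsolatingTwist G z →
        ∃ (N : ℕ) (k : ZMod N) (e : G ≃* Matrix.specialUnitaryGroup (Fin N) ℂ),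
          2 ≤ N ∧ IsUnit k ∧ Continuous e ∧ Continuous e.symm ∧
            e z = (suCenter N k : Matrix.specialUnitaryGroup (Fin N) ℂ) := by
  sorry

/-- **proposed stub (the located anchor, typed at `SU(N)`)** — T1 for `SU(N)`, generating twist `ω^k·1`, EVERY faithful `r`, with `∃ β₀` BEFORE `∀ L`
(= r-port ∘ M4; K38∕K39 + pool-p3's RepThreshold give it with `∃ β₀` after `∀ L`). -/
theorem stub_anchorSU :
    ∀ (N : ℕ) (k : ZMod N), 2 ≤ N → IsUnit k → ∀ n : ℕ, 0 < n →
      (suCenter N k : Matrix.specialUnitaryGroup (Fin N) ℂ) ^ n = 1 →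
      ∀ r : LatticeRep (Matrix.specialUnitaryGroup (Fin N) ℂ), ∃ (ℓ₀ : ℕ) (β₀ c C : ℝ), 2 ≤ ℓ₀ ∧ 0 < c ∧
        ∀ β : ℝ, β₀ ≤ β → ∀ L t : ℕ, 2 ≤ L → 1 ≤ t →
          projSlabDefect r.ρ β (suCenter N k : Matrix.specialUnitaryGroup (Fin N) ℂ) n ℓ₀ L t ≤
            C * (L : ℝ) * Real.exp (-(c * (t : ℝ))) := by
  sorry

/-- **T1 BY NAME from the two proposed stubs** (kernel-checked glue K41 `twistedSlabAnchor_of_classification_of_su`, p703209). -/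
theorem anchor_of_stubs : TwistedSlabAnchor :=
  twistedSlabAnchor_of_classification_of_su stub_isolatingTwistClassification stub_anchorSU

end Summit.QuantumFields.YangMills.Cruxes.IRcof.TwistedSlabContinuity.ReshapeR1

end
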